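import Mathlib.Algebra.BigOperators.Fin
import Literature.Computability.Complexity.MPGSignVerifier
import HarnessLib

/-!
# Mean-payoff games over the additive reals: the run of the certificate verifier

Topic `Literature/Computability/Complexity`, grouping namespace `MPGSignVerifier` (continuing
`MPGSignVerifier.lean`). Machine-free description of the run of `verifier` against the sign oracle
of `x ∈ ℝⁿ` on the input `⟨1ⁿ, y⟩` [FournierKoiran2000, §3: an `NDP⁰_ℝovs` verifier]:

* `signSet x` — the language of the sign oracle (`signOracle_eq_ofLanguage`), so that the toolkit
  of `AdaptiveQueries.lean` applies; `answers x e i` — the first `i` answer bits (the sign of the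
  `j`-th query, `j < i`); `adBits_verifier` — the transcript of `verifier` IS `answers`;
  **`run_verifier`** — within any budget exceeding `|⟨1ⁿ, y⟩|` the verifier outputs
  `accepts (n, y) (answers x (n, y) |⟨1ⁿ, y⟩|)`, and `run_verifier_eq_some_iff` (any budget);
* values of the queries at `x` (`qv x l` = the value of the affine form coded by `l`):
  `qv_nil`, `qv_unitQ` (`c + s·x_m`), `qv_geOne`/`qv_leOne`, `qv_potQ`
  (`pot u - pot v + x_w`, with `pot e x v = Σᵢ coef v i · xᵢ`);
* `forall_checks_iff_take_eq` — "the answers begin with the expected bits" iff every check is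
  answered as expected; membership of the slots in `checks` (`slotX_mem_checks`).

## References

* H. Fournier, P. Koiran, *Lower bounds are not easier over the reals: inside PH*, ICALP 2000,
  §2 Remark 1, §3. [FournierKoiran2000]
-/

namespace Literature.Computability.Complexity

namespace MPGSignVerifier

open _root_.Computability Brick AdQuery Finset

variable {n : ℕ}

/-! ### The sign oracle as a language oracle -/

/-- The language answered by the sign oracle of `x`: codes of affine forms non-negative at `x`.
[cite: FournierKoiran2000, §2 Remark 1] -/
def signSet (x : Fin n → ℝ) : Language Bool := {q | (0 : ℝ) ≤ affineQueryValue x q}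

/-- The indicator of `signSet x` is the sign bit. [folklore] -/
theorem boolIndicator_signSet (x : Fin n → ℝ) (q : List Bool) :
    (signSet x).boolIndicator q = decide ((0 : ℝ) ≤ affineQueryValue x q) := by
  by_cases h : (0 : ℝ) ≤ affineQueryValue x q
  · rw [(Set.mem_iff_boolIndicator _ _).1 (show q ∈ signSet x from h), decide_eq_true h]
  · rw [(Set.notMem_iff_boolIndicator _ _).1 (show q ∉ signSet x from h), decide_eq_false h]

/-- **The sign oracle is the language oracle of `signSet x`.** [cite: FournierKoiran2000, §2 Remark 1] -/
theorem signOracle_eq_ofLanguage (x : Fin n → ℝ) : signOracle x = Oracle.ofLanguage (signSet x) := by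
  funext q
  rw [Oracle.ofLanguage_apply, boolIndicator_signSet, signOracle_apply]

/-! ### Values of the queries -/

/-- The value at `x` of the affine form given by the integer list `l = [c, a₀, …]`. [cite: FournierKoiran2000, §2 Remark 1] -/
noncomputable def qv (x : Fin n → ℝ) (l : List ℤ) : ℝ := affineQueryValue x ((encodingIntBool.listBool).encode l)

/-- `qv` unfolded. [folklore] -/
theorem qv_eq (x : Fin n → ℝ) (l : List ℤ) :
    qv x l = ((l.getD 0 0 : ℤ) : ℝ) + ∑ i : Fin n, ((l.getD (i.val + 1) 0 : ℤ) : ℝ) * x i :=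
  affineQueryValue_encode x l

/-- The empty query has value `0`. [folklore] -/
@[simp] theorem qv_nil (x : Fin n → ℝ) : qv x [] = 0 := by
  simp [qv_eq]

/-- The potential `π v = Σᵢ coef v i · xᵢ` read off the witness. [folklore] -/
noncomputable def pot (e : Env) (x : Fin n → ℝ) (v : ℕ) : ℝ := ∑ i : Fin n, (coef e v i.val : ℝ) * x i

/-- Entries of a `cons`-`map range` list. [folklore] -/
private theorem getD_cons_map_range_succ (c : ℤ) (f : ℕ → ℤ) (i : Fin n) :
    (c :: (List.range n).map f).getD (i.val + 1) 0 = f i.val := by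
  rw [List.getD_cons_succ, List.getD_eq_getElem?_getD, List.getElem?_map,
    List.getElem?_range i.isLt]
  rfl

/-- Value of `unitQ`: `c + s · x_m`. [cite: FournierKoiran2000, §2 Remark 1] -/
theorem qv_unitQ (x : Fin n → ℝ) {m : ℕ} (hm : m < n) (c s : ℤ) :
    qv x (unitQ n m c s) = (c : ℝ) + (s : ℝ) * x ⟨m, hm⟩ := by
  rw [qv_eq, unitQ, List.getD_cons_zero]
  congr 1
  simp only [getD_cons_map_range_succ]
  rw [Finset.sum_eq_single ⟨m, hm⟩]
  · simp
  · intro i _ hi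
    have : i.val ≠ m := fun h => hi (Fin.ext h)
    simp [this]
  · simp

/-- Value of `geOne`: `x_m - 1`. [folklore] -/
theorem qv_geOne (x : Fin n → ℝ) {m : ℕ} (hm : m < n) : qv x (geOne n m) = x ⟨m, hm⟩ - 1 := by
  rw [geOne, qv_unitQ x hm]; push_cast; ring

/-- Value of `leOne`: `1 - x_m`. [folklore] -/
theorem qv_leOne (x : Fin n → ℝ) {m : ℕ} (hm : m < n) : qv x (leOne n m) = 1 - x ⟨m, hm⟩ := by
  rw [leOne, qv_unitQ x hm]; push_cast; ring

/-- Value of `potQ` (for an environment of dimension `n`): `π u - π v + x_w`, `w` the weight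
coordinate of `u → v`. [cite: CLRS2009, §24.4 (difference constraints)] -/
theorem qv_potQ (x : Fin n → ℝ) (y : List Bool) (u v : ℕ) {w : ℕ} (hw : wIdx (kOf (n, y)) u v = w) (hwn : w < n) :
    qv x (potQ (n, y) u v) = pot (n, y) x u - pot (n, y) x v + x ⟨w, hwn⟩ := by
  rw [qv_eq, potQ, List.getD_cons_zero]
  simp only [getD_cons_map_range_succ, Int.cast_zero, zero_add, hw]
  simp only [Int.cast_add, Int.cast_sub, Int.cast_natCast, add_mul, sub_mul, Finset.sum_add_distrib,
    Finset.sum_sub_distrib, pot]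
  congr 1
  rw [Finset.sum_eq_single ⟨w, hwn⟩]
  · simp
  · intro i _ hi
    have : i.val ≠ w := fun h => hi (Fin.ext h)
    simp [this]
  · simp

/-! ### The transcript and the run -/

/-- The first `i` answer bits of the run at `x`: the signs of the queries `0, …, i-1`. [folklore] -/
noncomputable def answers (x : Fin n → ℝ) (e : Env) (i : ℕ) : List Bool :=
  (List.range i).map fun j => decide ((0 : ℝ) ≤ qv x (queryAt e j))

/-- `answers … i` has `i` entries. [folklore] -/
@[simp] theorem length_answers (x : Fin n → ℝ) (e : Env) (i : ℕ) : (answers x e i).length = i := by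
  simp [answers]

/-- The query generator on a genuine transcript. [folklore] -/
theorem qgen_boolPair (m : ℕ) (y bits : List Bool) :
    qgen (boolPair (boolPair (unaryEncodeNat m) y) bits) = (encodingIntBool.listBool).encode (queryAt (m, y) bits.length) := by
  rw [qgen, envOf_boolPair, bitsOf_boolPair]

/-- **The transcript of the verifier is `answers`.** [folklore] -/
theorem adBits_verifier (x : Fin n → ℝ) (m : ℕ) (y : List Bool) :
    ∀ i, adBits qgen (signSet x) (boolPair (unaryEncodeNat m) y) i = answers x (m, y) i
  | 0 => by simp [answers]
  | i + 1 => by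
    rw [adBits_succ, adBits_verifier x m y i, qgen_boolPair, length_answers, boolIndicator_signSet, answers, answers,
      List.range_succ, List.map_append, List.map_singleton]
    rfl

/-- **The run of the verifier.** Within a budget exceeding `|⟨1ᵐ, y⟩|` rounds, against the sign
oracle of `x`, the verifier outputs `accepts (m, y) (answers x (m, y) |⟨1ᵐ, y⟩|)`.
[cite: FournierKoiran2000, §3 (NDP⁰_ℝovs)] -/
theorem run_verifier (x : Fin n → ℝ) (m : ℕ) (y : List Bool) {N : ℕ} (hN : (boolPair (unaryEncodeNat m) y).length < N) :
    verifier.run (signOracle x) N (boolPair (unaryEncodeNat m) y) =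
      some (accepts (m, y) (answers x (m, y) (boolPair (unaryEncodeNat m) y).length)) := by
  rw [signOracle_eq_ofLanguage, verifier, run_adAlg (signSet x) _ (by rwa [Polynomial.eval_X])]
  congr 1
  have hmem : boolPair (unaryEncodeNat m) y ∈ adLang qgen Polynomial.X Verdict (signSet x) ↔
      accepts (m, y) (answers x (m, y) (boolPair (unaryEncodeNat m) y).length) = true := by
    rw [mem_adLang_iff, Polynomial.eval_X, adBits_verifier]
    change accepts (envOf _) (bitsOf _) = true ↔ _
    rw [envOf_boolPair, bitsOf_boolPair]
  by_cases h : accepts (m, y) (answers x (m, y) (boolPair (unaryEncodeNat m) y).length) = true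
  · rw [h, (Set.mem_iff_boolIndicator _ _).1 (hmem.2 h)]
  · rw [(Set.notMem_iff_boolIndicator _ _).1 (fun h' => h (hmem.1 h')), Bool.eq_false_iff.2 h]

/-- **Acceptance within any budget is acceptance of the full transcript** (more rounds never
change an output, `OracleAlg.run_mono`). [folklore] -/
theorem accepts_of_run_eq_some_true (x : Fin n → ℝ) (m : ℕ) (y : List Bool) {N : ℕ}
    (h : verifier.run (signOracle x) N (boolPair (unaryEncodeNat m) y) = some true) :
    accepts (m, y) (answers x (m, y) (boolPair (unaryEncodeNat m) y).length) = true := by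
  have h1 := verifier.run_mono (signOracle x) (boolPair (unaryEncodeNat m) y)
    (le_max_left N ((boolPair (unaryEncodeNat m) y).length + 1)) h
  rw [run_verifier x m y (Nat.lt_of_lt_of_le (Nat.lt_succ_self _) (le_max_right _ _))] at h1
  exact Option.some.inj h1

/-! ### Checks answered as expected -/

/-- The value-level meaning of "the answers begin with the expected bits": every check is answered
as expected (given at least as many answers as checks). [folklore] -/
theorem take_answers_eq_expected_iff (x : Fin n → ℝ) (e : Env) {N : ℕ} (hN : (checks e).length ≤ N) :
    (answers x e N).take (expected e).length = expected e ↔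
      ∀ c ∈ checks e, decide ((0 : ℝ) ≤ qv x c.1) = c.2 := by
  have hlen : (expected e).length = (checks e).length := List.length_map _
  have htake : (answers x e N).take (expected e).length =
      (List.range (checks e).length).map fun j => decide ((0 : ℝ) ≤ qv x (queryAt e j)) := by
    rw [answers, hlen, ← List.map_take, List.take_range, min_eq_left hN]
  have hq : ∀ j, ∀ hj : j < (checks e).length, queryAt e j = ((checks e)[j]).1 := by
    intro j hj
    rw [queryAt, List.getD_eq_getElem?_getD, List.getElem?_map, List.getElem?_eq_getElem hj]
    rfl
  rw [htake]
  constructor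
  · intro h c hc
    obtain ⟨j, hj, rfl⟩ := List.mem_iff_getElem.1 hc
    have h1 := congrArg (fun l => l[j]?) h
    simp only [List.getElem?_map, List.getElem?_range hj, Option.map_some, expected,
      List.getElem?_eq_getElem hj] at h1
    rw [hq j hj] at h1
    exact Option.some.inj h1
  · intro h
    apply List.ext_getElem
    · simp [hlen]
    · intro j h₁ h₂
      rw [hlen] at h₂
      simp only [List.getElem_map, List.getElem_range, expected]
      rw [hq j h₂]
      exact h _ (List.getElem_mem h₂)

/-- The vertex slots are checks. [folklore] -/
theorem vertexSlots_subset_checks (e : Env) {u : ℕ} (hu : u < kOf e) {c : List ℤ × Bool}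
    (hc : c ∈ vertexSlots e u) : c ∈ checks e := by
  refine List.mem_append_left _ (List.mem_flatten.2 ⟨vertexSlots e u, ?_, hc⟩)
  exact List.mem_map.2 ⟨u, List.mem_range.2 hu, rfl⟩

/-- The pair slots are checks. [folklore] -/
theorem pairSlots_subset_checks (e : Env) {u u' : ℕ} (hu : u < kOf e) (hu' : u' < kOf e) {c : List ℤ × Bool}
    (hc : c ∈ pairSlots e u u') : c ∈ checks e := by
  refine List.mem_append_right _ (List.mem_flatten.2 ⟨rowSlots e u, List.mem_map.2 ⟨u, List.mem_range.2 hu, rfl⟩, ?_⟩)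
  exact List.mem_flatten.2 ⟨pairSlots e u u', List.mem_map.2 ⟨u', List.mem_range.2 hu', rfl⟩, hc⟩

/-- `slot1 e u ∈ checks e`. [folklore] -/
theorem slot1_mem_checks (e : Env) {u : ℕ} (hu : u < kOf e) : slot1 e u ∈ checks e :=
  vertexSlots_subset_checks e hu (by simp [vertexSlots])

/-- `slot2 e u ∈ checks e`. [folklore] -/
theorem slot2_mem_checks (e : Env) {u : ℕ} (hu : u < kOf e) : slot2 e u ∈ checks e :=
  vertexSlots_subset_checks e hu (by simp [vertexSlots])

/-- `slot3 e u ∈ checks e`. [folklore] -/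
theorem slot3_mem_checks (e : Env) {u : ℕ} (hu : u < kOf e) : slot3 e u ∈ checks e :=
  vertexSlots_subset_checks e hu (by simp [vertexSlots])

/-- `slot4 e u ∈ checks e`. [folklore] -/
theorem slot4_mem_checks (e : Env) {u : ℕ} (hu : u < kOf e) : slot4 e u ∈ checks e :=
  vertexSlots_subset_checks e hu (by simp [vertexSlots])

/-- `slot5 e u u' ∈ checks e`. [folklore] -/
theorem slot5_mem_checks (e : Env) {u u' : ℕ} (hu : u < kOf e) (hu' : u' < kOf e) : slot5 e u u' ∈ checks e :=
  pairSlots_subset_checks e hu hu' (by simp [pairSlots])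

/-- `slot6 e u u' ∈ checks e`. [folklore] -/
theorem slot6_mem_checks (e : Env) {u u' : ℕ} (hu : u < kOf e) (hu' : u' < kOf e) : slot6 e u u' ∈ checks e :=
  pairSlots_subset_checks e hu hu' (by simp [pairSlots])

/-- `slot7 e u u' ∈ checks e`. [folklore] -/
theorem slot7_mem_checks (e : Env) {u u' : ℕ} (hu : u < kOf e) (hu' : u' < kOf e) : slot7 e u u' ∈ checks e :=
  pairSlots_subset_checks e hu hu' (by simp [pairSlots])

/-! ### Well-formed environments and index bounds -/

section Env

variable {k : ℕ} {y : List Bool}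

/-- The environment of a well-formed input. [folklore] -/
def env (k : ℕ) (y : List Bool) : Env := (k + 2 * k * k, y)

/-- Its arena size. [folklore] -/
@[simp] theorem kOf_env : kOf (env k y) = k := arena_eq

/-- Its dimension. [folklore] -/
@[simp] theorem env_fst : (env k y).1 = k + 2 * k * k := rfl

/-- Index bound for pairs. [folklore] -/
theorem pair_lt {u u' : ℕ} (hu : u < k) (hu' : u' < k) : u * k + u' < k * k :=
  calc u * k + u' < u * k + k := by omega
    _ = (u + 1) * k := by ring
    _ ≤ k * k := Nat.mul_le_mul_right k hu

/-- Vertices are coordinates. [folklore] -/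
theorem vtx_lt {u : ℕ} (hu : u < k) : u < k + 2 * k * k := by nlinarith

/-- Edge indicators are coordinates (`edgeIdx k u u' = k + (uk + u')`). [folklore] -/
theorem edgeIdx_lt {u u' : ℕ} (hu : u < k) (hu' : u' < k) : k + (u * k + u') < k + 2 * k * k := by
  have := pair_lt hu hu'; nlinarith

/-- Weights are coordinates (`wIdx k u u' = k + k² + (uk + u')`). [folklore] -/
theorem wIdx_lt {u u' : ℕ} (hu : u < k) (hu' : u' < k) : k + k * k + (u * k + u') < k + 2 * k * k := by
  have := pair_lt hu hu'; nlinarith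

variable {k : ℕ} (hk : 0 < k) (y : List Bool)
include hk

/-- `tot u` is a vertex. [folklore] -/
theorem tot_lt (u : ℕ) : tot (env k y) u < k := by
  unfold tot; rw [kOf_env]; omega

/-- `succ u` is a vertex. [folklore] -/
theorem succ_lt (u : ℕ) : succ (env k y) u < k := by
  unfold succ; rw [kOf_env]; omega


end Env

end MPGSignVerifier

end Literature.Computability.Complexity
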